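import Summits.ResolutionOfSingularities.ResolutionOfSingularities.Theses.IndSmooth
import Summits.ResolutionOfSingularities.ResolutionOfSingularities.Theorems.IndSmoothSmoothToUniformizingLocalChart
import Summits.ResolutionOfSingularities.ResolutionOfSingularities.Theorems.IndSmoothSmoothToUniformizingSliceChart
import Summits.ResolutionOfSingularities.ResolutionOfSingularities.Theorems.IndSmoothSmoothToUniformizingModelOfInjectiveChart
import Summits.ResolutionOfSingularities.ResolutionOfSingularities.Theorems.IndSmoothSmoothToUniformizingRetractRegular
import Literature.AlgebraicGeometry.Resolution.ArithmeticalThreefolds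
import Literature.AlgebraicGeometry.Resolution.RegularLocusPerfectField
import Mathlib.RingTheory.Smooth.Locus
import HarnessLib

/-!
# The stuck-chart kernel of the crux `IndSmooth.SmoothToUniformizing`
# (stmt-ResolutionOfSingularities-16088, line `birth`, skeleton v6: dichotomy + certificate)

Route `ResolutionOfSingularities/IndSmooth`, crux #3 `SmoothToUniformizing` — the INJECTIVITY
UPGRADE: "for every prime `p`, if every finitely generated `R ⊆ O` (a valuation ring `O ⊇ k` of a
finitely generated field `K` over a perfect field `k` of characteristic `p`) factors `R → T → O`
through a SMOOTH `k`-algebra `T` (a smooth CHART), then relative local uniformization holds at `p`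
(a finitely generated `A`, `R ≤ A ⊆ O`, `Frac A = K`, `A` regular at the centre: a MODEL)".

This file assembles the CHART CALCULUS landed for line `birth` (v5/v6) into three kernel-checked
statements about the crux.

* `injective_or_stuck` — **the dichotomy** (unconditional): every LOCAL REGULAR CHART of
  `R ⊆ O ⊆ K` (a regular local `k`-algebra `L` essentially of finite type with `ψ : R → L`,
  `χ : L → K`, `χ(L) ⊆ O`, `χ⁻¹(𝔪_O) = 𝔪_L`, `χ ∘ ψ =` the inclusion) refines to one which is
  INJECTIVE or STUCK (`0 ≠ ker χ ⊆ 𝔪_L²`): slice by kernel elements outside `𝔪_L²`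
  (`stub_sliceChart`, Matsumura 14.2) as long as possible — induction on the embedding dimension.
  With `stub_localChart`: under ind-smoothness at `p`, EVERY `R ⊆ O` has an injective or a stuck
  local regular chart (`exists_injective_or_stuck_chart`).
* `smoothToUniformizing_of_stuckTowerStabilises` — **the crux REDUCES to its stuck-chart
  kernel**: if, given ind-smoothness at `p` and a STUCK local regular chart of `R` (`Frac R = K`),
  some finitely generated level `R ≤ B ⊆ O` carries a smooth chart retracting onto `B`, then
  `SmoothToUniformizing` holds (injective charts are models, `stub_modelOfInjectiveChart`; smooth
  retracts are regular, `stub_retractRegular`).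
* `stuckTowerStabilises_of_smoothToUniformizing` and `stuckTowerStabilises_iff` — **the kernel
  is crux-sized**: conversely the crux implies the kernel statement (a model `A` regular at the
  centre is smooth at the centre over the perfect `k`, Matsumura §30 Rem. 2, so some basic open
  `A_f ⊆ O` is smooth and is its own retracting chart). Hence KERNEL ⟺ CRUX, kernel-checked: the
  open stub `stub_stuckTowerStabilises` of `Cruxes/SmoothToUniformizing/Lines/birth.lean` (v6) is
  exactly as hard as the crux — which is the content of "filtered colimit ⇒ filtered union" once
  everything true about a single smooth chart has been used (AntieauDatta2021 §4 obtain unions only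
  from Temkin's uniformization theorems; no printed upgrade mechanism exists).

References: H. Matsumura, *Commutative Ring Theory*, Thm. 14.2, §30; B. Antieau, R. Datta,
*Valuation rings are derived splinters*, Math. Z. (2021), §4, Prop. 27.
-/

noncomputable section

-- single-problem summit: the doubled namespace component `ResolutionOfSingularities` is forced
set_option linter.dupNamespace false

open Summit.ResolutionOfSingularities.ResolutionOfSingularities.Theses.IndSmooth (SmoothToUniformizing)
open Literature.AlgebraicGeometry.Resolution (exists_affineModel isFractionRing_of_le
  isSmoothAt_iff_isRegularLocalRing_of_perfectField)
open IsLocalRing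

namespace Summit.ResolutionOfSingularities.ResolutionOfSingularities.Theorems.IndSmoothBirth

/-! ## The dichotomy: injective or stuck -/

/-- **Every local regular chart refines to an injective or a stuck one** (same `k, K, O, R`): if
`ker χ = 0` we are done; if some `g ∈ ker χ` lies outside `𝔪_L²`, slice (`stub_sliceChart`: the
embedding dimension drops by one); otherwise the chart is stuck. Induction on
`(𝔪_L).spanFinrank`, the bound `n` being explicit. [cite: Matsumura1987, Thm. 14.2] -/
theorem injective_or_stuck {k K : Type} [Field k] [Field K] [Algebra k K] (O : ValuationSubring K)
    (R : Subalgebra k K) :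
    ∀ (n : ℕ) (L : Type) [CommRing L] [IsRegularLocalRing L] [Algebra k L]
      [Algebra.EssFiniteType k L] (ψ : R →ₐ[k] L) (χ : L →ₐ[k] K),
      (∀ x : L, χ x ∈ O) → (∀ x : L, x ∈ maximalIdeal L ↔ O.valuation (χ x) < 1) →
      (∀ r : R, χ (ψ r) = (r : K)) → (maximalIdeal L).spanFinrank ≤ n →
      ∃ (L' : Type) (_ : CommRing L') (_ : IsRegularLocalRing L') (_ : Algebra k L')
        (_ : Algebra.EssFiniteType k L') (ψ' : R →ₐ[k] L') (χ' : L' →ₐ[k] K),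
        (∀ x : L', χ' x ∈ O) ∧ (∀ x : L', x ∈ maximalIdeal L' ↔ O.valuation (χ' x) < 1) ∧
          (∀ r : R, χ' (ψ' r) = (r : K)) ∧
          (Function.Injective χ' ∨
            (RingHom.ker χ' ≠ ⊥ ∧ ∀ g : L', χ' g = 0 → g ∈ (maximalIdeal L') ^ 2)) := by
  intro n
  induction n with
  | zero =>
    intro L _ _ _ _ ψ χ hχO hloc hψχ hle
    by_cases hst : ∀ g : L, χ g = 0 → g ∈ (maximalIdeal L) ^ 2
    · by_cases hker : RingHom.ker χ = ⊥
      · exact ⟨L, inferInstance, inferInstance, inferInstance, inferInstance, ψ, χ, hχO, hloc, hψχ,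
          Or.inl ((RingHom.injective_iff_ker_eq_bot χ).mpr hker)⟩
      · exact ⟨L, inferInstance, inferInstance, inferInstance, inferInstance, ψ, χ, hχO, hloc, hψχ,
          Or.inr ⟨hker, hst⟩⟩
    · push Not at hst
      obtain ⟨g, hg, hg2⟩ := hst
      obtain ⟨L', _, _, _, _, ψ', χ', -, -, -, hdim⟩ :=
        stub_sliceChart k K O R L ψ χ hχO hloc hψχ g hg hg2
      omega
  | succ n ih =>
    intro L _ _ _ _ ψ χ hχO hloc hψχ hle
    by_cases hst : ∀ g : L, χ g = 0 → g ∈ (maximalIdeal L) ^ 2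
    · by_cases hker : RingHom.ker χ = ⊥
      · exact ⟨L, inferInstance, inferInstance, inferInstance, inferInstance, ψ, χ, hχO, hloc, hψχ,
          Or.inl ((RingHom.injective_iff_ker_eq_bot χ).mpr hker)⟩
      · exact ⟨L, inferInstance, inferInstance, inferInstance, inferInstance, ψ, χ, hχO, hloc, hψχ,
          Or.inr ⟨hker, hst⟩⟩
    · push Not at hst
      obtain ⟨g, hg, hg2⟩ := hst
      obtain ⟨L', _, _, _, _, ψ', χ', hχO', hloc', hψχ', hdim⟩ :=
        stub_sliceChart k K O R L ψ χ hχO hloc hψχ g hg hg2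
      exact ih L' ψ' χ' hχO' hloc' hψχ' (by omega)

/-- **Under ind-smoothness every `R ⊆ O` has an injective or a stuck local regular chart.** If
every finitely generated `R ⊆ O` (over perfect fields of characteristic `p`) admits a smooth
chart, then it admits a LOCAL REGULAR chart (`stub_localChart`) which is injective or stuck
(`injective_or_stuck`). [cite: Matsumura1987, Thm. 14.2] -/
theorem exists_injective_or_stuck_chart (p : ℕ)
    (hind : ∀ (k K : Type) [Field k] [CharP k p] [PerfectField k] [Field K] [Algebra k K],
      (⊤ : IntermediateField k K).FG → ∀ O : ValuationSubring K, (∀ c : k, algebraMap k K c ∈ O) →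
      ∀ R : Subalgebra k K, R.FG → R.toSubring ≤ O.toSubring →
      ∃ (T : Type) (_ : CommRing T) (_ : Algebra k T), Algebra.Smooth k T ∧
        ∃ (ψ : R →ₐ[k] T) (χ : T →ₐ[k] K), (∀ t : T, χ t ∈ O) ∧ ∀ r : R, χ (ψ r) = (r : K))
    (k K : Type) [Field k] [CharP k p] [PerfectField k] [Field K] [Algebra k K]
    (hK : (⊤ : IntermediateField k K).FG) (O : ValuationSubring K)
    (hO : ∀ c : k, algebraMap k K c ∈ O) (R : Subalgebra k K) (hR : R.FG)
    (hRO : R.toSubring ≤ O.toSubring) :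
    ∃ (L : Type) (_ : CommRing L) (_ : IsRegularLocalRing L) (_ : Algebra k L)
      (_ : Algebra.EssFiniteType k L) (ψ : R →ₐ[k] L) (χ : L →ₐ[k] K),
      (∀ x : L, χ x ∈ O) ∧ (∀ x : L, x ∈ maximalIdeal L ↔ O.valuation (χ x) < 1) ∧
        (∀ r : R, χ (ψ r) = (r : K)) ∧
        (Function.Injective χ ∨
          (RingHom.ker χ ≠ ⊥ ∧ ∀ g : L, χ g = 0 → g ∈ (maximalIdeal L) ^ 2)) := by
  obtain ⟨T, _, _, hT, ψ, χ, hχO, hψχ⟩ := hind k K hK O hO R hR hRO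
  haveI := hT
  obtain ⟨L, _, _, _, _, ψL, χL, hχLO, hlocL, hψχL⟩ := stub_localChart k K O R T ψ χ hχO hψχ
  exact injective_or_stuck O R _ L ψL χL hχLO hlocL hψχL le_rfl

/-! ## The crux reduces to the stuck-chart kernel -/

/-- **`SmoothToUniformizing` from the stuck-chart kernel.** Suppose that for every prime `p`,
ind-smoothness at `p` together with a STUCK local regular chart of a finitely generated `R ⊆ O`
with `Frac R = K` produces a finitely generated level `R ≤ B ⊆ O` carrying a smooth chart that
retracts onto `B` (`χ'(T) ⊆ B`). Then the crux holds: enlarge `R` by an affine model of `K` in `O`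
(`exists_affineModel`); by `exists_injective_or_stuck_chart` it has an injective local regular
chart — a model (`stub_modelOfInjectiveChart`) — or a stuck one — handed to the kernel, whose
level `B` is regular at the centre by `stub_retractRegular` and has `Frac B = K` as `R ≤ B`.
[cite: AntieauDatta2021, Prop. 27] -/
theorem smoothToUniformizing_of_stuckTowerStabilises
    (hkernel : ∀ p : ℕ, p.Prime →
      (∀ (k K : Type) [Field k] [CharP k p] [PerfectField k] [Field K] [Algebra k K],
        (⊤ : IntermediateField k K).FG → ∀ O : ValuationSubring K,
        (∀ c : k, algebraMap k K c ∈ O) → ∀ R : Subalgebra k K, R.FG →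
        R.toSubring ≤ O.toSubring →
        ∃ (T : Type) (_ : CommRing T) (_ : Algebra k T), Algebra.Smooth k T ∧
          ∃ (ψ : R →ₐ[k] T) (χ : T →ₐ[k] K), (∀ t : T, χ t ∈ O) ∧ ∀ r : R, χ (ψ r) = (r : K)) →
      ∀ (k K : Type) [Field k] [CharP k p] [PerfectField k] [Field K] [Algebra k K],
        (⊤ : IntermediateField k K).FG → ∀ O : ValuationSubring K,
        (∀ c : k, algebraMap k K c ∈ O) → ∀ R : Subalgebra k K, R.FG →
        R.toSubring ≤ O.toSubring → IsFractionRing R K →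
        ∀ (L : Type) [CommRing L] [IsRegularLocalRing L] [Algebra k L] [Algebra.EssFiniteType k L]
          (ψ : R →ₐ[k] L) (χ : L →ₐ[k] K),
          (∀ x : L, χ x ∈ O) → (∀ x : L, x ∈ maximalIdeal L ↔ O.valuation (χ x) < 1) →
          (∀ r : R, χ (ψ r) = (r : K)) →
          RingHom.ker χ ≠ ⊥ → (∀ g : L, χ g = 0 → g ∈ (maximalIdeal L) ^ 2) →
          ∃ (B : Subalgebra k K) (_ : B.toSubring ≤ O.toSubring), R ≤ B ∧ B.FG ∧
            ∃ (T : Type) (_ : CommRing T) (_ : Algebra k T), Algebra.Smooth k T ∧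
              ∃ (ψ' : B →ₐ[k] T) (χ' : T →ₐ[k] K),
                (∀ b : B, χ' (ψ' b) = (b : K)) ∧ ∀ t : T, χ' t ∈ B) :
    SmoothToUniformizing := by
  intro p hp hind k K _ _ _ _ _ hK O hO R hR hRO
  -- enlarge `R` by an affine model `A₀ ⊆ O` of `K`
  obtain ⟨A₀, hA₀O, hA₀fg, hA₀fr⟩ := exists_affineModel k K hK O hO
  have hR₁O : (R ⊔ A₀).toSubring ≤ O.toSubring := by
    let Oalg : Subalgebra k K := { O.toSubring with algebraMap_mem' := hO }
    change R ⊔ A₀ ≤ Oalg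
    exact sup_le (fun x hx => hRO hx) (fun x hx => hA₀O hx)
  have hR₁fg : (R ⊔ A₀).FG := hR.sup hA₀fg
  have hR₁fr : IsFractionRing ↥(R ⊔ A₀) K := isFractionRing_of_le le_sup_right hA₀fr
  have hRR₁ : R ≤ R ⊔ A₀ := le_sup_left
  -- an injective or a stuck local regular chart of `R ⊔ A₀`
  obtain ⟨L, _, _, _, _, ψ, χ, hχO, hloc, hψχ, hcases⟩ :=
    exists_injective_or_stuck_chart p hind k K hK O hO (R ⊔ A₀) hR₁fg hR₁O
  rcases hcases with hinj | ⟨hker, hstuck⟩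
  · -- injective chart: a model
    obtain ⟨A, hA, hR₁A, hAfg, hAfr, hreg⟩ :=
      stub_modelOfInjectiveChart k K O (R ⊔ A₀) hR₁fg hR₁O hR₁fr L ψ χ hχO hloc hψχ hinj
    exact ⟨A, hA, hRR₁.trans hR₁A, hAfg, hAfr, hreg⟩
  · -- stuck chart: the kernel, then the retract lemma
    obtain ⟨B, hB, hR₁B, hBfg, T, _, _, hT, ψB, χB, hψχB, hrange⟩ :=
      hkernel p hp hind k K hK O hO (R ⊔ A₀) hR₁fg hR₁O hR₁fr L ψ χ hχO hloc hψχ hker hstuck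
    haveI := hT
    exact ⟨B, hB, hRR₁.trans hR₁B, hBfg, isFractionRing_of_le hR₁B hR₁fr,
      stub_retractRegular k K O B hB hBfg T ψB χB hψχB hrange⟩

/-! ## Conversely: the kernel is crux-sized -/

section SmoothLevel

variable {k K : Type} [Field k] [Field K] [Algebra k K]

/-- **A model regular at the centre contains, after inverting one element, a SMOOTH level.**
Over a perfect field `k`: if `A ⊆ O` is finitely generated and `A` localized at the centre
`𝔪_O ∩ A` is regular, then `A` is smooth over `k` at the centre (Matsumura §30 Rem. 2), the smooth
locus is open, so some `f ∈ A` outside the centre has `A_f` smooth; `B := A[1/f] ⊆ O` is then a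
finitely generated level containing `A` with the retracting smooth chart `T = A_f ≅ B`.
[cite: Matsumura1987, §30 Remark 2 after Thm. 30.3] -/
theorem exists_smooth_level_of_isRegularLocalRing [PerfectField k] (O : ValuationSubring K)
    (A : Subalgebra k K) (hA : A.toSubring ≤ O.toSubring) (hAfg : A.FG)
    (hreg : IsRegularLocalRing (Localization.AtPrime
      (Ideal.comap (Subring.inclusion hA) (IsLocalRing.maximalIdeal O)))) :
    ∃ (B : Subalgebra k K) (_ : B.toSubring ≤ O.toSubring), A ≤ B ∧ B.FG ∧
      ∃ (T : Type) (_ : CommRing T) (_ : Algebra k T), Algebra.Smooth k T ∧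
        ∃ (ψ' : B →ₐ[k] T) (χ' : T →ₐ[k] K),
          (∀ b : B, χ' (ψ' b) = (b : K)) ∧ ∀ t : T, χ' t ∈ B := by
  classical
  set 𝔞 : Ideal A := Ideal.comap (Subring.inclusion hA) (IsLocalRing.maximalIdeal O) with h𝔞
  haveI h𝔞p : 𝔞.IsPrime := Ideal.comap_isPrime _ _
  haveI : Algebra.FiniteType k A := ⟨(Subalgebra.fg_top A).mpr hAfg⟩
  haveI : Algebra.FinitePresentation k A := (Algebra.FinitePresentation.of_finiteType).mp ‹_›
  -- smooth at the centre, hence on a basic open neighbourhood `D(f)`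
  have hsm : Algebra.IsSmoothAt k 𝔞 :=
    (isSmoothAt_iff_isRegularLocalRing_of_perfectField k A 𝔞).mpr hreg
  have hmem : (⟨𝔞, h𝔞p⟩ : PrimeSpectrum A) ∈ Algebra.smoothLocus k A := hsm
  obtain ⟨_, ⟨_, ⟨f, rfl⟩, rfl⟩, hf𝔞, hfD⟩ :=
    PrimeSpectrum.isBasis_basic_opens.exists_subset_of_mem_open hmem Algebra.isOpen_smoothLocus
  have hfnot : f ∉ 𝔞 := by simpa using hf𝔞
  have hTsm : Algebra.Smooth k (Localization.Away f) :=
    Algebra.basicOpen_subset_smoothLocus_iff_smooth.mp hfD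
  -- `f` is a unit of `O`: valuation `1`, so `f ≠ 0` in `K` and `f⁻¹ ∈ O`
  have hfval : O.valuation (f : K) = 1 := by
    have hfO' : (⟨(f : K), hA f.2⟩ : O) ∉ IsLocalRing.maximalIdeal O := fun h =>
      hfnot (by rw [h𝔞, Ideal.mem_comap]; exact h)
    rw [ValuationSubring.valuation_lt_one_iff] at hfO'
    exact le_antisymm (O.valuation_le_one ⟨(f : K), hA f.2⟩) (not_lt.mp hfO')
  have hf0 : (f : K) ≠ 0 := by
    intro h0; rw [h0, map_zero] at hfval; exact zero_ne_one hfval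
  have hf0A : f ≠ 0 := by
    intro h0; exact hf0 (by rw [h0]; rfl)
  have hyval : ∀ y : Submonoid.powers f, O.valuation ((y : A) : K) = 1 := by
    rintro ⟨_, n, rfl⟩
    simp [map_pow, hfval]
  have hyinvO : ∀ y : Submonoid.powers f, (((y : A) : K))⁻¹ ∈ O := fun y =>
    (O.valuation_le_one_iff _).mp (by rw [map_inv₀, hyval, inv_one])
  have hy0 : ∀ y : Submonoid.powers f, ((y : A) : K) ≠ 0 := fun y h0 => by
    have := hyval y; rw [h0, map_zero] at this; exact zero_ne_one this
  -- the chart `T = A_f → K`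
  let T := Localization.Away f
  have hunits : ∀ y : Submonoid.powers f, IsUnit (A.val y) := fun y => (hy0 y).isUnit
  let χ' : T →ₐ[k] K := IsLocalization.liftAlgHom (M := Submonoid.powers f) (f := A.val) hunits
  have hχ'alg : ∀ a : A, χ' (algebraMap A T a) = (a : K) := fun a =>
    IsLocalization.lift_eq (M := Submonoid.powers f) hunits a
  have hχ'mk : ∀ (a : A) (y : Submonoid.powers f),
      χ' (IsLocalization.mk' T a y) = (a : K) * (((y : A) : K))⁻¹ := by
    intro a y
    change IsLocalization.lift hunits _ = _
    rw [IsLocalization.lift_mk'_spec]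
    change (a : K) = ((y : A) : K) * ((a : K) * (((y : A) : K))⁻¹)
    field_simp [hy0 y]
  -- values in `O`
  have hχ'O : ∀ t : T, χ' t ∈ O := by
    intro t
    obtain ⟨⟨a, y⟩, rfl⟩ := IsLocalization.mk'_surjective (Submonoid.powers f) t
    change χ' (IsLocalization.mk' T a y) ∈ O
    rw [hχ'mk]
    exact O.mul_mem _ _ (hA a.2) (hyinvO y)
  -- injectivity
  have hinj : Function.Injective χ' := by
    change Function.Injective (IsLocalization.lift (M := Submonoid.powers f) hunits)
    rw [IsLocalization.lift_injective_iff]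
    intro x y
    rw [(IsLocalization.injective T
      (powers_le_nonZeroDivisors_of_noZeroDivisors hf0A)).eq_iff]
    constructor
    · rintro rfl; rfl
    · intro h; exact Subtype.ext h
  -- the level `B = χ'(T) = A[1/f]`
  haveI := hTsm
  refine ⟨χ'.range, ?_, ?_, ?_, T, inferInstance, inferInstance, hTsm, ?_⟩
  · rintro x ⟨t, rfl⟩
    exact hχ'O t
  · intro a ha
    exact ⟨algebraMap A T ⟨a, ha⟩, hχ'alg ⟨a, ha⟩⟩
  · rw [← Algebra.map_top]
    exact Subalgebra.FG.map _ Algebra.FiniteType.out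
  · let e : T ≃ₐ[k] χ'.range := AlgEquiv.ofInjective χ' hinj
    refine ⟨(e.symm : χ'.range →ₐ[k] T), χ', fun b => ?_, fun t => ⟨t, rfl⟩⟩
    change χ' (e.symm b) = (b : K)
    rw [← AlgEquiv.ofInjective_apply χ' hinj, AlgEquiv.apply_symm_apply]

end SmoothLevel

/-- **The crux implies its stuck-chart kernel** (so the kernel is crux-sized): given
`SmoothToUniformizing`, ind-smoothness at `p` yields a model `A ⊇ R` regular at the centre, and
`exists_smooth_level_of_isRegularLocalRing` a level `B ⊇ A ⊇ R` with a retracting smooth chart —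
the stuck chart offered by the kernel's hypotheses is not even looked at.
[cite: Matsumura1987, §30 Remark 2 after Thm. 30.3] -/
theorem stuckTowerStabilises_of_smoothToUniformizing (h : SmoothToUniformizing) :
    ∀ p : ℕ, p.Prime →
      (∀ (k K : Type) [Field k] [CharP k p] [PerfectField k] [Field K] [Algebra k K],
        (⊤ : IntermediateField k K).FG → ∀ O : ValuationSubring K,
        (∀ c : k, algebraMap k K c ∈ O) → ∀ R : Subalgebra k K, R.FG →
        R.toSubring ≤ O.toSubring →
        ∃ (T : Type) (_ : CommRing T) (_ : Algebra k T), Algebra.Smooth k T ∧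
          ∃ (ψ : R →ₐ[k] T) (χ : T →ₐ[k] K), (∀ t : T, χ t ∈ O) ∧ ∀ r : R, χ (ψ r) = (r : K)) →
      ∀ (k K : Type) [Field k] [CharP k p] [PerfectField k] [Field K] [Algebra k K],
        (⊤ : IntermediateField k K).FG → ∀ O : ValuationSubring K,
        (∀ c : k, algebraMap k K c ∈ O) → ∀ R : Subalgebra k K, R.FG →
        R.toSubring ≤ O.toSubring → IsFractionRing R K →
        ∀ (L : Type) [CommRing L] [IsRegularLocalRing L] [Algebra k L] [Algebra.EssFiniteType k L]
          (ψ : R →ₐ[k] L) (χ : L →ₐ[k] K),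
          (∀ x : L, χ x ∈ O) → (∀ x : L, x ∈ maximalIdeal L ↔ O.valuation (χ x) < 1) →
          (∀ r : R, χ (ψ r) = (r : K)) →
          RingHom.ker χ ≠ ⊥ → (∀ g : L, χ g = 0 → g ∈ (maximalIdeal L) ^ 2) →
          ∃ (B : Subalgebra k K) (_ : B.toSubring ≤ O.toSubring), R ≤ B ∧ B.FG ∧
            ∃ (T : Type) (_ : CommRing T) (_ : Algebra k T), Algebra.Smooth k T ∧
              ∃ (ψ' : B →ₐ[k] T) (χ' : T →ₐ[k] K),
                (∀ b : B, χ' (ψ' b) = (b : K)) ∧ ∀ t : T, χ' t ∈ B := by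
  intro p hp hind k K _ _ _ _ _ hK O hO R hR hRO _ _L _ _ _ _ _ψ _χ _ _ _ _ _
  obtain ⟨A, hA, hRA, hAfg, -, hreg⟩ := h p hp hind k K hK O hO R hR hRO
  obtain ⟨B, hB, hAB, hBfg, T, _, _, hT, ψ', χ', hψχ', hrange⟩ :=
    exists_smooth_level_of_isRegularLocalRing O A hA hAfg hreg
  exact ⟨B, hB, hRA.trans hAB, hBfg, T, _, _, hT, ψ', χ', hψχ', hrange⟩

/-- **KERNEL ⟺ CRUX.** The open stub `stub_stuckTowerStabilises` of line `birth` (skeleton v6: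
"given ind-smoothness at `p` and a stuck local regular chart of `R`, some level `R ≤ B ⊆ O` has a
retracting smooth chart") is EQUIVALENT to `SmoothToUniformizing`: the chart calculus
(`stub_localChart`, `stub_sliceChart`, `stub_modelOfInjectiveChart`, `stub_retractRegular`, all
landed) leaves no slack. [cite: AntieauDatta2021, Prop. 27] -/
theorem stuckTowerStabilises_iff :
    (∀ p : ℕ, p.Prime →
      (∀ (k K : Type) [Field k] [CharP k p] [PerfectField k] [Field K] [Algebra k K],
        (⊤ : IntermediateField k K).FG → ∀ O : ValuationSubring K,
        (∀ c : k, algebraMap k K c ∈ O) → ∀ R : Subalgebra k K, R.FG →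
        R.toSubring ≤ O.toSubring →
        ∃ (T : Type) (_ : CommRing T) (_ : Algebra k T), Algebra.Smooth k T ∧
          ∃ (ψ : R →ₐ[k] T) (χ : T →ₐ[k] K), (∀ t : T, χ t ∈ O) ∧ ∀ r : R, χ (ψ r) = (r : K)) →
      ∀ (k K : Type) [Field k] [CharP k p] [PerfectField k] [Field K] [Algebra k K],
        (⊤ : IntermediateField k K).FG → ∀ O : ValuationSubring K,
        (∀ c : k, algebraMap k K c ∈ O) → ∀ R : Subalgebra k K, R.FG →
        R.toSubring ≤ O.toSubring → IsFractionRing R K →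
        ∀ (L : Type) [CommRing L] [IsRegularLocalRing L] [Algebra k L] [Algebra.EssFiniteType k L]
          (ψ : R →ₐ[k] L) (χ : L →ₐ[k] K),
          (∀ x : L, χ x ∈ O) → (∀ x : L, x ∈ maximalIdeal L ↔ O.valuation (χ x) < 1) →
          (∀ r : R, χ (ψ r) = (r : K)) →
          RingHom.ker χ ≠ ⊥ → (∀ g : L, χ g = 0 → g ∈ (maximalIdeal L) ^ 2) →
          ∃ (B : Subalgebra k K) (_ : B.toSubring ≤ O.toSubring), R ≤ B ∧ B.FG ∧
            ∃ (T : Type) (_ : CommRing T) (_ : Algebra k T), Algebra.Smooth k T ∧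
              ∃ (ψ' : B →ₐ[k] T) (χ' : T →ₐ[k] K),
                (∀ b : B, χ' (ψ' b) = (b : K)) ∧ ∀ t : T, χ' t ∈ B) ↔
    SmoothToUniformizing :=
  ⟨smoothToUniformizing_of_stuckTowerStabilises, stuckTowerStabilises_of_smoothToUniformizing⟩

end Summit.ResolutionOfSingularities.ResolutionOfSingularities.Theorems.IndSmoothBirth

end
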